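import Summits.MatrixMultiplication.MatrixMultiplication.Theorems.ObstructionDescentUniversalOccurrenceTwoRectangleThreeThreeOneWitness

set_option linter.dupNamespace false
set_option autoImplicit false

/-!
# Universal occurrence — two rectangles and the shape `(2N-7,3,3,1)` (decomp-mm · lens 3 · gen 46)

Route `route-MatrixMultiplication-ObstructionDescent` (sub-problem `MatrixMultiplication`, `ω(ℂ) = 2`); SUPPORT for the crux
`NoOccurrenceObstruction` (`P_O`, item `stmt-MatrixMultiplication-29040`): the universal-occurrence programme (NODE-g29…g46
of the decomp-mm cell, lens 3) in the currency of the tree — `((2^N),(2^N),ν)` occurs in the coordinate ring of the orbit of the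
unit tensor `⟨m⟩`.  Nothing here proves `ω = 2` or closes an item; no `def`, no `sorry`, standard axioms.

**The kernel** (`occurs_unitTensor_twoRectangle_threeThreeOne`): for all `N ≥ 5` and `m ≥ N + 2` the triple
`((2^N),(2^N),(2N-7,3,3,1))` occurs for `⟨m⟩`.  It is fed to the entry theorem
`occurs_unitTensor_twoRectangle_of_liftDesign_ne_zero` (part `…TwoRectangleStorey`) with the crossed lift design `D″(N)`:
positions `q < 2N` with block structure `e q = (q % 2, q / 2)` for the first leg and `e' = e ∘ κ`, `κ = (0 1)(6 7)`, for the
second (so the second rectangle is evaluated on a block structure crossing the first one in the slots `0` and `3`); lifts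
`φ`, `ψ` of the identity of `[N]` to `[N+2]` with `φ(N), φ(N+1) = 0, 1` and `ψ(N), ψ(N+1) = 1, 0`; third leg `γ` with
`γ(1) = γ(3) = 1`, `γ(2) = γ(N+1) = 2`, `γ(N) = 3`, `γ = 0` elsewhere, read by the polytabloid of the standard tableau `T″`
of shape `(2N-7,3,3,1)` (column `0` on the positions `0,1,2,3`, columns `1`, `2` on `4,5,6` and `7,8,9`, arm on the dominoes
`{10,11}, {12,13}, …`).

**The certificate.**  The storey sum `Σ_ι ζ_e(φ∘ι) ζ_{e'}(ψ∘ι) e_T(γ∘ι)` over words `ι : [2N] → [N+2]` is evaluated in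
closed form up to sign-free counting: (i) a supported word is well formed — the letters `N`, `N+1` occur exactly once, at
positions `p_N`, `p_M` (part `…ThreeThreeOneLift`); (ii) if the word TOGGLES (`p_N`, `p_M` in one block of `e` and in one
block of `e'`), then `ι ∘ π`, `π = κβ` (`β` the block flip `q ↦ q ± 1`), toggles too and contributes the opposite term —
`π` acts on `e_T` by `-1` (an odd column permutation of `T″` times whole arm dominoes, part `…ThreeThreeOneTableaux`),
while the two block signs are exchanged (`threeThreeOne_toggle_symm`) and invariant under the block relabelling `β`; so the
toggling words cancel (`Finset.sum_ninvolution`); (iii) a supported non-toggling word contributes exactly `-1` (the value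
law `threeThreeOne_liftTerm_eq`, part `…ThreeThreeOneValue`, resting on the block-sign law `twist_blockSign_mul` of part
`…TwistSign` and the finite sign model of part `…ThreeThreeOneArith`).  Hence the storey sum is minus the number of supported
non-toggling words, and the explicit witness `ι_w = (N+1, N, 0, 1, 2, 3, 4, 4, 3, 2, 5, 5, 6, 6, …)` is one of them.
(Numerically the sum is `-360` for `N = 5` and `-1600` for `N = 6`.)

Why this family matters for `P_O`: `(2N-7,3,3,1)` has two rows of length `3`, i.e. tail multiplicities `(N-4,1,1,0)` —
the first universal-occurrence kernel outside the hook and `(a,b,1,1)` families of NODE-g40…g45, and the smallest instance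
of the crossed-design mechanism (`e' ≠ e`), which is what the two-row tails require (NODE-g44 §2, critic g23 ruling (2)).

[cite: BurgisserIkenmeyer2011, Thm. 4.4, Lemma 6.1] [cite: BurgisserIkenmeyer2017, §5, Thm. 5.9 (proof of (2)), eq. (3.4)]
-/

noncomputable section

open scoped BigOperators

namespace Summit.MatrixMultiplication.MatrixMultiplication.Theorems.ObstructionCalculus

open Literature.Computability.AlgebraicComplexity
open Literature.NumberTheory.DiophantineGeometry

set_option maxHeartbeats 1600000 in
/-- **`((2^N),(2^N),(2N-7,3,3,1))` occurs for `⟨m⟩` for all `N ≥ 5`, `m ≥ N + 2`** — the first universal-occurrence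
kernel whose third shape has two rows of length `3` (tail multiplicities `(N-4,1,1,0)` mod the two rectangles; outside the
hook / `(a,b,1,1)` families of NODE-g40…g45).  Certificate: the storey sum of the crossed lift design `D″(N)` equals minus
the number of its supported non-toggling words (toggling words cancel under `ι ↦ ι ∘ π`), and the witness word is one of them.
[cite: BurgisserIkenmeyer2011, Thm. 4.4, Lemma 6.1] [cite: BurgisserIkenmeyer2017, §5, Thm. 5.9 (proof of (2)), eq. (3.4)] -/
theorem occurs_unitTensor_twoRectangle_threeThreeOne {N m : ℕ} (hN : 5 ≤ N) (hNm : N + 2 ≤ m)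
    {lam : Fin 3 → Nat.Partition (N * 2)} (h0 : lam 0 = Nat.Partition.rectangle N 2)
    (h1 : lam 1 = Nat.Partition.rectangle N 2) (h2 : (lam 2).sortedParts = [2 * N - 7, 3, 3, 1]) :
    isotypicSum₁ (lam 0) (isotypicSum₂ (lam 1) (isotypicSum₃ (lam 2)
      (kroneckerPow (unitTensor ℂ m) (N * 2)))) ≠ 0 := by
  classical
  /- 1 · the shape, the tableau `T″`, the highest weight vector -/
  have hNY : ∀ x ∈ (lam 2).youngDiagram.cells, x.1 < N := fun x hx => by
    have := fst_lt_of_mem_youngDiagram_threeThreeOne (lam 2) h2 hx; omega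
  have hd : (lam 2).youngDiagram.cells.card = N * 2 := Nat.Partition.card_cells_youngDiagram _
  have h10 : 10 ≤ N * 2 := by omega
  obtain ⟨T, hT⟩ : ∃ T : StdFilling (N * 2) (lam 2).youngDiagram, ∀ p : Fin (N * 2), T.1 p =
      (if (p : ℕ) < 4 then ((p : ℕ), 0)
        else if (p : ℕ) < 10 then (((p : ℕ) - 4) % 3, ((p : ℕ) - 4) / 3 + 1) else (0, (p : ℕ) - 7)) :=
    ⟨⟨fun p => if (p : ℕ) < 4 then ((p : ℕ), 0)
        else if (p : ℕ) < 10 then (((p : ℕ) - 4) % 3, ((p : ℕ) - 4) / 3 + 1) else (0, (p : ℕ) - 7),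
      ⟨fun p => threeThreeOneCell_mem hN (lam 2) h2 p p.2,
       fun p q hpq => Fin.ext (threeThreeOneCell_injective hpq),
       fun p q hpq => threeThreeOneCell_standard hpq⟩⟩, fun p => rfl⟩
  have hM : StdFilling.polytabloid ℂ hNY T ∈
      highestWeightSpace (wordRep ℂ N (N * 2)) (Weight.ofPartition N (lam 2)) := by
    rw [← ydWeight_youngDiagram]; exact StdFilling.polytabloid_mem hNY T hd
  /- 2 · positions, the block structure `e q = (q % 2, q / 2)` -/
  obtain ⟨p0, hp0⟩ : ∃ p : Fin (N * 2), (p : ℕ) = 0 := ⟨⟨0, by omega⟩, rfl⟩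
  obtain ⟨p1, hp1⟩ : ∃ p : Fin (N * 2), (p : ℕ) = 1 := ⟨⟨1, by omega⟩, rfl⟩
  obtain ⟨p6, hp6⟩ : ∃ p : Fin (N * 2), (p : ℕ) = 6 := ⟨⟨6, by omega⟩, rfl⟩
  obtain ⟨p7, hp7⟩ : ∃ p : Fin (N * 2), (p : ℕ) = 7 := ⟨⟨7, by omega⟩, rfl⟩
  have hpne : ∀ {q q' : Fin (N * 2)}, (q : ℕ) ≠ (q' : ℕ) → q ≠ q' := fun h hqq' => h (congrArg Fin.val hqq')
  obtain ⟨e, he⟩ : ∃ e : Fin (N * 2) ≃ Fin 2 × Fin N,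
      e = finProdFinEquiv.symm.trans (Equiv.prodComm (Fin N) (Fin 2)) := ⟨_, rfl⟩
  have hev : ∀ q : Fin (N * 2), (((e q).1 : Fin 2) : ℕ) = (q : ℕ) % 2 ∧ (((e q).2 : Fin N) : ℕ) = (q : ℕ) / 2 := by
    intro q; rw [he]; simp [Fin.modNat, Fin.divNat]
  have hesymm : ∀ (a : Fin 2) (s : Fin N), ((e.symm (a, s) : Fin (N * 2)) : ℕ) = (a : ℕ) + 2 * (s : ℕ) := by
    intro a s
    obtain ⟨ha, hs⟩ := hev (e.symm (a, s))
    rw [Equiv.apply_symm_apply] at ha hs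
    dsimp only at ha hs
    omega
  /- 3 · the double cross `κ = (p₀ p₁)(p₆ p₇)`, the block flip `β`, the involution `π = κβ`, `e' = e ∘ κ` -/
  obtain ⟨κ, hκ⟩ : ∃ κ : Equiv.Perm (Fin (N * 2)), κ = Equiv.swap p0 p1 * Equiv.swap p6 p7 := ⟨_, rfl⟩
  have hκv : ∀ q : Fin (N * 2), ((κ q : Fin (N * 2)) : ℕ) =
      (if (q : ℕ) = 0 then 1 else if (q : ℕ) = 1 then 0 else if (q : ℕ) = 6 then 7 else if (q : ℕ) = 7 then 6 else (q : ℕ)) := by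
    intro q
    rw [hκ, Equiv.Perm.mul_apply]
    have h67 : ∀ r : Fin (N * 2), (r : ℕ) ≠ 6 → (r : ℕ) ≠ 7 → Equiv.swap p6 p7 r = r := fun r h6 h7 =>
      Equiv.swap_apply_of_ne_of_ne (hpne (by rw [hp6]; exact h6)) (hpne (by rw [hp7]; exact h7))
    have h01 : ∀ r : Fin (N * 2), (r : ℕ) ≠ 0 → (r : ℕ) ≠ 1 → Equiv.swap p0 p1 r = r := fun r hr0 hr1 =>
      Equiv.swap_apply_of_ne_of_ne (hpne (by rw [hp0]; exact hr0)) (hpne (by rw [hp1]; exact hr1))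
    by_cases hq0 : (q : ℕ) = 0
    · rw [h67 q (by omega) (by omega), show q = p0 from Fin.ext (by rw [hq0, hp0]), Equiv.swap_apply_left, hp0, hp1]
      simp
    by_cases hq1 : (q : ℕ) = 1
    · rw [h67 q (by omega) (by omega), show q = p1 from Fin.ext (by rw [hq1, hp1]), Equiv.swap_apply_right, hp0, hp1]
      simp
    by_cases hq6 : (q : ℕ) = 6
    · rw [show q = p6 from Fin.ext (by rw [hq6, hp6]), Equiv.swap_apply_left,
        h01 p7 (by rw [hp7]; omega) (by rw [hp7]; omega), hp6, hp7]
      simp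
    by_cases hq7 : (q : ℕ) = 7
    · rw [show q = p7 from Fin.ext (by rw [hq7, hp7]), Equiv.swap_apply_right,
        h01 p6 (by rw [hp6]; omega) (by rw [hp6]; omega), hp6, hp7]
      simp
    rw [h67 q hq6 hq7, h01 q hq0 hq1, if_neg hq0, if_neg hq1, if_neg hq6, if_neg hq7]
  have hκκ : ∀ q, κ (κ q) = q := fun q => Fin.ext (threeThreeOne_kappa_kappa (hκv q) (hκv (κ q)))
  obtain ⟨β, hβv⟩ : ∃ β : Equiv.Perm (Fin (N * 2)), ∀ q, ((β q : Fin (N * 2)) : ℕ) =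
      (if (q : ℕ) % 2 = 0 then (q : ℕ) + 1 else (q : ℕ) - 1) := by
    obtain ⟨f, hf⟩ : ∃ f : Fin (N * 2) → Fin (N * 2), ∀ q, ((f q : Fin (N * 2)) : ℕ) =
        (if (q : ℕ) % 2 = 0 then (q : ℕ) + 1 else (q : ℕ) - 1) :=
      ⟨fun q => ⟨(if (q : ℕ) % 2 = 0 then (q : ℕ) + 1 else (q : ℕ) - 1), by have := q.2; split_ifs <;> omega⟩, fun q => rfl⟩
    have hff : Function.LeftInverse f f := fun q => Fin.ext (threeThreeOne_beta_beta (hf q) (hf (f q)))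
    exact ⟨⟨f, f, hff, hff⟩, hf⟩
  have hββ : ∀ q, β (β q) = q := fun q => Fin.ext (threeThreeOne_beta_beta (hβv q) (hβv (β q)))
  have hβblk : ∀ q, e (β q) = (Equiv.swap 0 1 (e q).1, (e q).2) := by
    intro q
    have hsw : ∀ a : Fin 2, ((Equiv.swap (0 : Fin 2) 1 a : Fin 2) : ℕ) = 1 - (a : ℕ) := by decide
    have hbk := threeThreeOne_beta_block (hβv q)
    have hb := hβv q
    refine Prod.ext (Fin.ext ?_) (Fin.ext ?_)
    · show (((e (β q)).1 : Fin 2) : ℕ) = ((Equiv.swap (0 : Fin 2) 1 (e q).1 : Fin 2) : ℕ)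
      rw [(hev (β q)).1, hsw, (hev q).1]; omega
    · show (((e (β q)).2 : Fin N) : ℕ) = (((e q).2 : Fin N) : ℕ)
      rw [(hev (β q)).2, (hev q).2]; split_ifs at hb <;> omega
  obtain ⟨π, hπ⟩ : ∃ π : Equiv.Perm (Fin (N * 2)), π = κ * β := ⟨_, rfl⟩
  have hπa : ∀ q, π q = κ (β q) := fun q => by rw [hπ, Equiv.Perm.mul_apply]
  have hπv : ∀ q : Fin (N * 2), ((π q : Fin (N * 2)) : ℕ) =
      (if (q : ℕ) = 2 then 3 else if (q : ℕ) = 3 then 2 else if (q : ℕ) = 4 then 5 else if (q : ℕ) = 5 then 4 else if (q : ℕ) = 8 then 9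
      else if (q : ℕ) = 9 then 8 else if (q : ℕ) < 10 then (q : ℕ) else if (q : ℕ) % 2 = 0 then (q : ℕ) + 1 else (q : ℕ) - 1) := fun q => by
    rw [hπa]; exact threeThreeOne_kappa_beta (hβv q) (hκv (β q))
  have hκβc : ∀ q, κ (β q) = β (κ q) := fun q =>
    Fin.ext (threeThreeOne_kappa_beta_comm (hβv q) (hκv (β q)) (hκv q) (hβv (κ q)))
  have hππ : ∀ q, π (π q) = q := fun q => by rw [hπa, hπa, hκβc q, hββ, hκκ]
  have hπκ : ∀ q, π (κ q) = β q := fun q => by rw [hπa, hκβc, hκκ]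
  have hπblk : ∀ q : Fin (N * 2), ((π q : Fin (N * 2)) : ℕ) % 2 + ((κ q : Fin (N * 2)) : ℕ) % 2 = 1 := fun q => by
    rw [hπa, hκβc]; exact threeThreeOne_beta_block (hβv (κ q))
  have hκπblk : ∀ q : Fin (N * 2), ((κ (π q) : Fin (N * 2)) : ℕ) % 2 + (q : ℕ) % 2 = 1 := fun q => by
    rw [hπa, hκκ]; exact threeThreeOne_beta_block (hβv q)
  obtain ⟨e', he'⟩ : ∃ e' : Fin (N * 2) ≃ Fin 2 × Fin N, e' = κ.symm.trans e := ⟨_, rfl⟩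
  have hζ' : ∀ y : Word N (N * 2), wordBlockSign ℂ e' y = wordBlockSign ℂ e (y ∘ ⇑κ) := by
    intro y; rw [he', wordBlockSign_comp_perm]
  /- 4 · the design `D″(N)` on the alphabet `[N+2]` -/
  obtain ⟨φ, hφv⟩ : ∃ φ : Fin (N + 2) → Fin N, ∀ r, ((φ r : Fin N) : ℕ) =
      if (r : ℕ) < N then (r : ℕ) else (r : ℕ) - N :=
    ⟨fun r => ⟨if (r : ℕ) < N then (r : ℕ) else (r : ℕ) - N, by have := r.2; split_ifs <;> omega⟩, fun r => rfl⟩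
  obtain ⟨ψ, hψv⟩ : ∃ ψ : Fin (N + 2) → Fin N, ∀ r, ((ψ r : Fin N) : ℕ) =
      if (r : ℕ) < N then (r : ℕ) else N + 1 - (r : ℕ) :=
    ⟨fun r => ⟨if (r : ℕ) < N then (r : ℕ) else N + 1 - (r : ℕ), by have := r.2; split_ifs <;> omega⟩, fun r => rfl⟩
  obtain ⟨γ, hγv⟩ : ∃ γ : Fin (N + 2) → Fin N, ∀ r, ((γ r : Fin N) : ℕ) =
      if (r : ℕ) = 1 then 1 else if (r : ℕ) = 2 then 2 else if (r : ℕ) = 3 then 1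
      else if (r : ℕ) = N then 3 else if (r : ℕ) = N + 1 then 2 else 0 :=
    ⟨fun r => ⟨if (r : ℕ) = 1 then 1 else if (r : ℕ) = 2 then 2 else if (r : ℕ) = 3 then 1
        else if (r : ℕ) = N then 3 else if (r : ℕ) = N + 1 then 2 else 0, by split_ifs <;> omega⟩, fun r => rfl⟩
  refine occurs_unitTensor_twoRectangle_of_liftDesign_ne_zero (le_trans (Nat.le_add_right N 2) hNm) hNm φ ψ γ e e'
    h0 h1 hM ?_
  -- the term `F` and the toggling predicate `A`
  obtain ⟨F, hF⟩ : ∃ F : (Fin (N * 2) → Fin (N + 2)) → ℂ, ∀ ι, F ι =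
      wordBlockSign ℂ e (φ ∘ ι) * (wordBlockSign ℂ e ((ψ ∘ ι) ∘ ⇑κ) * StdFilling.polytabloid ℂ hNY T (γ ∘ ι)) :=
    ⟨_, fun _ => rfl⟩
  obtain ⟨A, hA⟩ : ∃ A : (Fin (N * 2) → Fin (N + 2)) → Prop, ∀ ι, A ι ↔ ∃ pN pM : Fin (N * 2),
      ((ι pN : Fin (N + 2)) : ℕ) = N ∧ (∀ q, ((ι q : Fin (N + 2)) : ℕ) = N → q = pN) ∧
      ((ι pM : Fin (N + 2)) : ℕ) = N + 1 ∧ (∀ q, ((ι q : Fin (N + 2)) : ℕ) = N + 1 → q = pM) ∧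
      ((e pN).1 = (e pM).1 ∧ (e (κ pN)).1 = (e (κ pM)).1) := ⟨_, fun _ => Iff.rfl⟩
  have hsumF : (∑ ι : Fin (N * 2) → Fin (N + 2),
      wordBlockSign ℂ e (φ ∘ ι) * (wordBlockSign ℂ e' (ψ ∘ ι) * StdFilling.polytabloid ℂ hNY T (γ ∘ ι))) =
      ∑ ι : Fin (N * 2) → Fin (N + 2), F ι :=
    Finset.sum_congr rfl fun ι _ => by rw [hF, hζ']
  rw [hsumF]
  /- 5 · toggling words cancel under `ι ↦ ι ∘ π` -/
  have hflip : ∀ ι, A ι → F (ι ∘ ⇑π) = -F ι := by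
    intro ι hAι
    obtain ⟨pN, pM, hpN, hNu, hpM, hMu, htog⟩ := (hA ι).1 hAι
    have hxπ : φ ∘ (ι ∘ ⇑π) = ((φ ∘ ι) ∘ ⇑κ) ∘ ⇑β := funext fun q => by
      show φ (ι (π q)) = φ (ι (κ (β q))); rw [hπa]
    have hyπ : (ψ ∘ (ι ∘ ⇑π)) ∘ ⇑κ = (ψ ∘ ι) ∘ ⇑β := funext fun q => by
      show ψ (ι (π (κ q))) = ψ (ι (β q)); rw [hπκ]
    rw [hF, hF, hxπ, hyπ, wordBlockSign_comp_blockRelabel e (Equiv.swap 0 1) β hβblk,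
      wordBlockSign_comp_blockRelabel e (Equiv.swap 0 1) β hβblk,
      show γ ∘ (ι ∘ ⇑π) = (γ ∘ ι) ∘ ⇑π from rfl, threeThreeOneTableau_comp_flip hNY T hT h10 π hπv (γ ∘ ι),
      show wordBlockSign ℂ e (φ ∘ ι) * (wordBlockSign ℂ e ((ψ ∘ ι) ∘ ⇑κ) * StdFilling.polytabloid ℂ hNY T (γ ∘ ι)) =
        (wordBlockSign ℂ e (φ ∘ ι) * wordBlockSign ℂ e ((ψ ∘ ι) ∘ ⇑κ)) * StdFilling.polytabloid ℂ hNY T (γ ∘ ι) from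
        (mul_assoc _ _ _).symm,
      threeThreeOne_toggle_symm e κ hκκ hφv hψv ι hpN hNu hpM hMu htog]
    ring
  have hππ' : ∀ ι : Fin (N * 2) → Fin (N + 2), (ι ∘ ⇑π) ∘ ⇑π = ι := fun ι =>
    funext fun q => by show ι (π (π q)) = ι q; rw [hππ]
  have hAπ : ∀ ι, A ι → A (ι ∘ ⇑π) := by
    intro ι hAι
    obtain ⟨pN, pM, hpN, hNu, hpM, hMu, htog⟩ := (hA ι).1 hAι
    refine (hA _).2 ⟨π pN, π pM, ?_, ?_, ?_, ?_, ?_⟩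
    · show ((ι (π (π pN)) : Fin (N + 2)) : ℕ) = N
      rw [hππ]; exact hpN
    · intro q hq
      rw [← hNu (π q) hq, hππ]
    · show ((ι (π (π pM)) : Fin (N + 2)) : ℕ) = N + 1
      rw [hππ]; exact hpM
    · intro q hq
      rw [← hMu (π q) hq, hππ]
    · have ht1 := congrArg Fin.val htog.1
      have ht2 := congrArg Fin.val htog.2
      rw [(hev pN).1, (hev pM).1] at ht1
      rw [(hev (κ pN)).1, (hev (κ pM)).1] at ht2
      have b1 := hπblk pN; have b2 := hπblk pM; have b3 := hκπblk pN; have b4 := hκπblk pM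
      exact ⟨Fin.ext (by rw [(hev (π pN)).1, (hev (π pM)).1]; omega),
        Fin.ext (by rw [(hev (κ (π pN))).1, (hev (κ (π pM))).1]; omega)⟩
  have hAsum : (∑ ι : Fin (N * 2) → Fin (N + 2), if A ι then F ι else 0) = 0 := by
    refine Finset.sum_ninvolution (fun ι => ι ∘ ⇑π) (fun ι => ?_) (fun ι hι => ?_) (fun _ => Finset.mem_univ _)
      (fun ι => hππ' ι)
    · show (if A ι then F ι else 0) + (if A (ι ∘ ⇑π) then F (ι ∘ ⇑π) else 0) = 0
      by_cases hAι : A ι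
      · rw [if_pos hAι, if_pos (hAπ ι hAι), hflip ι hAι, add_neg_cancel]
      · have hAι' : ¬ A (ι ∘ ⇑π) := fun h => hAι (by have h' := hAπ _ h; rwa [hππ'] at h')
        rw [if_neg hAι, if_neg hAι', add_zero]
    · intro hfix
      apply hι
      show (if A ι then F ι else 0) = 0
      by_cases hAι : A ι
      · have h := hflip ι hAι
        rw [hfix] at h
        rw [if_pos hAι]
        linear_combination (1 / 2 : ℂ) * h
      · rw [if_neg hAι]
  /- 6 · a supported non-toggling word contributes `-1` -/
  have hBterm : ∀ ι, (if A ι then 0 else F ι) = -(if ¬ A ι ∧ F ι ≠ 0 then (1 : ℂ) else 0) := by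
    intro ι
    by_cases hAι : A ι
    · rw [if_pos hAι, if_neg (fun h => h.1 hAι), neg_zero]
    · rw [if_neg hAι]
      by_cases hFι : F ι = 0
      · rw [if_neg (fun h => h.2 hFι), hFι, neg_zero]
      · rw [if_pos ⟨hAι, hFι⟩]
        rw [hF] at hFι ⊢
        have hx : wordBlockSign ℂ e (φ ∘ ι) ≠ 0 := fun h => hFι (by rw [h, zero_mul])
        have hw : StdFilling.polytabloid ℂ hNY T (γ ∘ ι) ≠ 0 := fun h => hFι (by rw [h, mul_zero, mul_zero])
        obtain ⟨pN, pM, hpN, hNu, hpM, hMu⟩ := threeThreeOne_lift_wf hN hNY T hT e hφv hγv ι hx hw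
        have hsep : (e pN).1 ≠ (e pM).1 ∨ (e (κ pN)).1 ≠ (e (κ pM)).1 := by
          by_contra hc
          push Not at hc
          exact hAι ((hA ι).2 ⟨pN, pM, hpN, hNu, hpM, hMu, hc⟩)
        exact threeThreeOne_liftTerm_eq hN hNY T hT e hev hp0 hp1 hp6 hp7 κ hκ hκv hφv hψv hγv ι hpN hNu hpM hMu
          hsep hFι
  /- 7 · the storey sum is minus the number of supported non-toggling words -/
  intro hsum
  have hsplit : (∑ ι : Fin (N * 2) → Fin (N + 2), F ι) =
      (∑ ι : Fin (N * 2) → Fin (N + 2), if A ι then F ι else 0) +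
        ∑ ι : Fin (N * 2) → Fin (N + 2), if A ι then 0 else F ι := by
    rw [← Finset.sum_add_distrib]
    exact Finset.sum_congr rfl fun ι _ => by split_ifs <;> simp
  rw [hsplit, hAsum, zero_add, Finset.sum_congr rfl (fun ι _ => hBterm ι), Finset.sum_neg_distrib, neg_eq_zero,
    Finset.sum_boole, Nat.cast_eq_zero, Finset.card_eq_zero, Finset.filter_eq_empty_iff] at hsum
  /- 8 · the witness word -/
  obtain ⟨ιw, hιw⟩ : ∃ ι : Fin (N * 2) → Fin (N + 2), ∀ q, ((ι q : Fin (N + 2)) : ℕ) =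
      (if (q : ℕ) = 0 then N + 1 else if (q : ℕ) = 1 then N else if (q : ℕ) < 7 then (q : ℕ) - 2 else if (q : ℕ) < 10 then 11 - (q : ℕ) else (q : ℕ) / 2) :=
    ⟨fun q => ⟨(if (q : ℕ) = 0 then N + 1 else if (q : ℕ) = 1 then N else if (q : ℕ) < 7 then (q : ℕ) - 2 else if (q : ℕ) < 10 then 11 - (q : ℕ) else (q : ℕ) / 2),
        by have := q.2; split_ifs <;> omega⟩, fun q => rfl⟩
  have hnotA : ¬ A ιw := fun h => by
    obtain ⟨pN, pM, hpN, -, hpM, -, htog⟩ := (hA ιw).1 h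
    have hvN := hιw pN; rw [hpN] at hvN
    have hvM := hιw pM; rw [hpM] at hvM
    have hpN1 : (pN : ℕ) = 1 := by have := pN.2; split_ifs at hvN <;> omega
    have hpM0 : (pM : ℕ) = 0 := by have := pM.2; split_ifs at hvM <;> omega
    have ht := congrArg Fin.val htog.1
    rw [(hev pN).1, (hev pM).1, hpN1, hpM0] at ht
    omega
  refine hsum (Finset.mem_univ ιw) ⟨hnotA, ?_⟩
  -- the first leg of the witness, and the agreement of the twisted second leg with it
  have hxwv : ∀ q : Fin (N * 2), (((φ ∘ ιw) q : Fin N) : ℕ) =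
      (if (q : ℕ) = 0 then 1 else if (q : ℕ) = 1 then 0 else if (q : ℕ) < 7 then (q : ℕ) - 2 else if (q : ℕ) < 10 then 11 - (q : ℕ) else (q : ℕ) / 2) := by
    intro q; show ((φ (ιw q) : Fin N) : ℕ) = _; rw [hφv]; exact threeThreeOneWitness_fst hN q.2 (hιw q)
  have hχw : (ψ ∘ ιw) ∘ ⇑κ = φ ∘ ιw := by
    funext q; apply Fin.ext
    show ((ψ (ιw (κ q)) : Fin N) : ℕ) = (((φ ∘ ιw) q : Fin N) : ℕ)
    rw [hxwv, hψv]
    exact threeThreeOneWitness_snd hN q.2 (hκv q) (hιw (κ q))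
  have hblkw0 : ∀ s : Fin N, (((φ ∘ ιw) (e.symm (0, s)) : Fin N) : ℕ) =
      (if (s : ℕ) = 0 then 1 else if (s : ℕ) = 1 then 0 else if (s : ℕ) = 3 then 4 else if (s : ℕ) = 4 then 3 else (s : ℕ)) := by
    intro s; rw [hxwv, hesymm, Fin.val_zero]; exact threeThreeOneWitness_block0
  have hblkw1 : ∀ s : Fin N, (((φ ∘ ιw) (e.symm (1, s)) : Fin N) : ℕ) =
      (if (s : ℕ) = 2 then 3 else if (s : ℕ) = 3 then 4 else if (s : ℕ) = 4 then 2 else (s : ℕ)) := by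
    intro s; rw [hxwv, hesymm, Fin.val_one]; exact threeThreeOneWitness_block1
  have hbijw : ∀ a : Fin 2, Function.Bijective (fun s => (φ ∘ ιw) (e.symm (a, s))) := by
    intro a
    have ha : a = 0 ∨ a = 1 := by
      rcases Nat.lt_or_ge (a : ℕ) 1 with h | h
      · exact Or.inl (Fin.ext (by rw [Fin.val_zero]; omega))
      · exact Or.inr (Fin.ext (by rw [Fin.val_one]; have := a.2; omega))
    refine (Finite.injective_iff_bijective).1 fun s s' h => Fin.ext ?_
    have h' : (((φ ∘ ιw) (e.symm (a, s)) : Fin N) : ℕ) = (((φ ∘ ιw) (e.symm (a, s')) : Fin N) : ℕ) :=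
      congrArg Fin.val h
    rcases ha with rfl | rfl
    · rw [hblkw0, hblkw0] at h'
      exact threeThreeOneWitness_block0_inj h'
    · rw [hblkw1, hblkw1] at h'
      exact threeThreeOneWitness_block1_inj h'
  have hxw0 : wordBlockSign ℂ e (φ ∘ ιw) ≠ 0 := by
    unfold wordBlockSign
    rw [if_pos hbijw]
    exact Finset.prod_ne_zero_iff.2 fun a _ => Int.cast_ne_zero.2 (Units.ne_zero _)
  -- the third leg of the witness is supported: columns `(2,3,0,1)`, `(2,1,0)`, `(0,1,2)`, zero arm
  have hwwv : ∀ q : Fin (N * 2), (((γ ∘ ιw) q : Fin N) : ℕ) =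
      (if (q : ℕ) = 0 then 2 else if (q : ℕ) = 1 then 3 else if (q : ℕ) = 2 then 0 else if (q : ℕ) = 3 then 1 else if (q : ℕ) = 4 then 2
      else if (q : ℕ) = 5 then 1 else if (q : ℕ) = 8 then 1 else if (q : ℕ) = 9 then 2 else 0) := by
    intro q; show ((γ (ιw q) : Fin N) : ℕ) = _; rw [hγv]; exact threeThreeOneWitness_third hN q.2 (hιw q)
  have harmw : ∀ q : Fin (N * 2), 10 ≤ (q : ℕ) → (((γ ∘ ιw) q : Fin N) : ℕ) = 0 := fun q hq => by
    rw [hwwv]; split_ifs <;> omega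
  have hlt0w : ∀ q : Fin (N * 2), (q : ℕ) < 4 → (((γ ∘ ιw) q : Fin N) : ℕ) < 4 := fun q hq => by
    rw [hwwv]; split_ifs <;> omega
  have hlt12w : ∀ q : Fin (N * 2), 4 ≤ (q : ℕ) → (q : ℕ) < 10 → (((γ ∘ ιw) q : Fin N) : ℕ) < 3 := fun q _ _ => by
    rw [hwwv]; split_ifs <;> omega
  have hinjw : ∀ q q' : Fin (N * 2), (((q : ℕ) < 4 ∧ (q' : ℕ) < 4) ∨ (4 ≤ (q : ℕ) ∧ (q : ℕ) < 7 ∧ 4 ≤ (q' : ℕ) ∧ (q' : ℕ) < 7) ∨ (7 ≤ (q : ℕ) ∧ (q : ℕ) < 10 ∧ 7 ≤ (q' : ℕ) ∧ (q' : ℕ) < 10)) →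
      (γ ∘ ιw) q = (γ ∘ ιw) q' → q = q' := fun q q' hcol h => by
    have h' := congrArg Fin.val h
    rw [hwwv q, hwwv q'] at h'
    exact Fin.ext (threeThreeOneWitness_third_inj hcol h')
  obtain ⟨π₀, π₁, π₂, -, -, -, hval⟩ := threeThreeOne_perms_of_support hNY T hT h10 harmw hlt0w hlt12w
    (fun q q' hq hq' h => hinjw q q' (Or.inl ⟨hq, hq'⟩) h)
    (fun q q' h1 h2 h3 h4 h => hinjw q q' (Or.inr (Or.inl ⟨h1, h2, h3, h4⟩)) h)
    (fun q q' h1 h2 h3 h4 h => hinjw q q' (Or.inr (Or.inr ⟨h1, h2, h3, h4⟩)) h)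
  rw [hF, hχw, ← mul_assoc, wordBlockSign_mul_self_of_ne_zero e hxw0, one_mul, hval]
  exact mul_ne_zero (mul_ne_zero (Int.cast_ne_zero.2 (Units.ne_zero _)) (Int.cast_ne_zero.2 (Units.ne_zero _)))
    (Int.cast_ne_zero.2 (Units.ne_zero _))

end Summit.MatrixMultiplication.MatrixMultiplication.Theorems.ObstructionCalculus

end
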